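import Summits.ResolutionOfSingularities.ResolutionOfSingularities.Theorems.MarkedTransferCampaignW46ThreefoldsSucc
import HarnessLib

/-!
# [OURS · L1 W4.6 rung (ii)] The reading-generic reductions with off-centre monotonicity asked ONLY AT SINGULAR POINTS
# (`StringReading.MonotoneSingShape`, StringReading.lean v2) — the FINAL FORM of rung (ii) for both readings (proofs)

Cell res-hironaka, LADDER-RESOLUTION rung L (D-0089), slot W4.6, rung (ii); seat res-L1-s46-pv-3 (gen 2). Host route
MarkedTransfer, host item `HypersurfaceOrderReductionDimLeThree` (stmt-16156); `--kind proof --supports` it. Companion of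
`…StringReading` v2, `…StringReadingReduction` (the same reductions under `MonotoneShape`) and `…ThreefoldsSucc` (instances).

HONEST FRAMING. Everything below is OURS: pure logic over the campaign shapes plus the tree's order theory, topology and
blow-up library; NOTHING here is a statement of H. Hironaka's manuscript (2017-03-23, [Hironaka2017]) and nothing asserts that
any statement of it holds. All shapes are HYPOTHESES. AI review is weaker than expert review.

## What

`MonotoneShape` consults the `Inv`-strings at ALL closed points off the centre, including non-singular ones where Eq. (34)
p.24 defines no `Inv_ξ` (the scope issue lane B recorded on `NablaTop`, answered by `NablaTopSing`). The reductions only ever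
use it at points whose image is SINGULAR for `E` (points of `∇(E′) ⊆ Sing(E′)` and points over `∇(E) ∖ D`), so they hold
verbatim under the weaker `MonotoneSingShape`: `terminatesWhole_of_shapes_sing`, `terminatesNabla_of_shapes_sing` (regime
inside `dimLE d`, OUR MEASURE v2). FINAL RUNG (ii) FORMS, for EVERY string reading `σ` (so for (M) `readingM` and (M⁺)
`readingMSucc` at once): `terminatesWholeII_of_shapes_sing`, `terminatesNablaII_of_shapes_sing`
(`σ.DecreaseShape Rd regimeII → σ.PrefixShape Rd regimeII → σ.StopsShape Rd regimeII → σ.TopSingShape Rd regimeII →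
σ.MonotoneSingShape Rd regimeII → TerminatesNablaII N Rd`, the dimension bound `3` consumed by the measure), the named-(M) and
named-(M⁺) corollaries, and the host-words form `not_divergesFromNabla_hostState_of_shapes_sing`.

References: `…StringReading` v2; `…StringReadingReduction` (p486044); `…ThreefoldsSucc` (p486417); Threefolds.lean v5
(p485187); `…ThreefoldsMeasure` (p484132); `…ThreefoldsRegime` (p480316). H. Hironaka, ms. 2017-03-23, Th. 16.6 p.84, §16.3
p.87, Eq. (34) p.24 — scope only, under adjudication, not cited as fact. [Hironaka2017]
-/

noncomputable section

set_option linter.dupNamespace false -- mandated namespace of this single-conjunct summit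

open CategoryTheory AlgebraicGeometry TopologicalSpace

namespace Summit.ResolutionOfSingularities.ResolutionOfSingularities.Theorems

namespace CampaignW46

open Literature.AlgebraicGeometry.Resolution
open Literature.AlgebraicGeometry.Hironaka2017
open Literature.AlgebraicGeometry.Hironaka2017.S02Preliminaries
open Literature.AlgebraicGeometry.Hironaka2017.Datum
open Literature.AlgebraicGeometry.Hironaka2017.S15ARSchemes
open Literature.AlgebraicGeometry.Hironaka2017.S16Proof
open Literature.AlgebraicGeometry.Hironaka2017.InvStringOrder

universe u

variable {n : ℕ} {p : ℕ} [Fact p.Prime] {K : Type u} [Field K] [CharP K p]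

/-- `MonotoneShape → MonotoneSingShape` (the singular-points form is weaker). [folklore] -/
theorem StringReading.monotoneSingShape_of_monotoneShape {N : Notions.{u} n} {Rd : Reading p K N} {Rg : Regime p K}
    (σ : StringReading p K N) (h : σ.MonotoneShape Rd Rg) : σ.MonotoneSingShape Rd Rg :=
  fun A E R hRg hRd A' s R' hRd' ξ' hξ' _ hD => h A E R hRg hRd A' s R' hRd' ξ' hξ' hD

namespace StringReading

/-! ## One whole step: the top string drops -/

section WholeStep

variable {N : Notions.{u} n} {Rd : Reading p K N} {Rg : Regime p K} (σ : StringReading p K N)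
variable {A A' : AmbientDatum p K} {E : IdealExponent A.Z} {R : Resume N A E}

/-- THE ONE-STEP DESCENT for a whole step under the reading `σ`: at every closed `η′ ∈ ∇(E′)` the `σ`-string of `R′` is
strictly below the top `σ`-string of `R`, and `σ.len R′ ≤ σ.len R`. Over the centre (`∇′ = ∅`): `DecreaseShape` and (T1).
Off the centre: `π η′ ∈ Sing(E) ∖ ∇(E)` is closed, (T2-Sing) puts its string strictly below the top, and `MonotoneShape`
says the string upstairs is not above it (`lexLT_of_not_lexLT_of_lexLT`). [folklore] -/
theorem descent_of_whole_sing (hD : σ.DecreaseShape Rd Rg) (hM : σ.StopsShape Rd Rg)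
    (hL : σ.MonotoneSingShape Rd Rg)
    (hRg : Rg A E) (hRd : Rd A E R) (s : Step R A') (hwhole : (s.D : Set A.Z) = (R.nabla : Set A.Z)) {η : A.Z}
    (hT1 : ∀ ξ : A.Z, ξ ∈ Literature.AlgebraicGeometry.Hironaka2017.S02Preliminaries.closedPoints A.Z →
      ξ ∈ (R.nabla : Set A.Z) → σ.str R ξ = σ.str R η)
    (hT2 : ∀ ξ : A.Z, ξ ∈ Literature.AlgebraicGeometry.Hironaka2017.S02Preliminaries.closedPoints A.Z →
      ξ ∈ E.sing → ξ ∉ (R.nabla : Set A.Z) → InvString.LexLT (σ.str R ξ) (σ.str R η))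
    {E' : IdealExponent A'.Z} (hE' : E' = s.E') (R' : Resume N A' E') (hRd' : Rd A' E' R') {η' : A'.Z}
    (hη'n : η' ∈ (R'.nabla : Set A'.Z))
    (hη' : η' ∈ Literature.AlgebraicGeometry.Hironaka2017.S02Preliminaries.closedPoints A'.Z) :
    InvString.LexLT (σ.str R' η') (σ.str R η) ∧ σ.len R' ≤ σ.len R := by
  subst hE'
  have hζ := s.apply_mem_closedPoints hη'
  have hζs : s.π η' ∈ E.sing := s.apply_mem_sing (R'.nabla_subset_sing hη'n)
  refine ⟨?_, hM A E R hRg hRd A' s R' hRd'⟩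
  by_cases hD' : s.π η' ∈ (s.D : Set A.Z)
  · have hnot : η' ∉ strictTransformSet s.π (s.D : Set A.Z) (R.nabla : Set A.Z) := by
      rw [s.strictTransformSet_eq_empty_of_whole hwhole]
      exact Set.notMem_empty _
    have h127 := hD A E R hRg hRd A' s R' hRd' η' hη' hD' hnot
    have hin : s.π η' ∈ (R.nabla : Set A.Z) := by
      rw [← hwhole]
      exact hD'
    rwa [hT1 _ hζ hin] at h127
  · have hmono := hL A E R hRg hRd A' s R' hRd' η' hη' hζs hD'
    have hnot : s.π η' ∉ (R.nabla : Set A.Z) := by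
      rw [← hwhole]
      exact hD'
    exact lexLT_of_not_lexLT_of_lexLT hmono (hT2 _ hζ hζs hnot)

/-- **WHOLE-∇ REDUCTION FOR EVERY STRING READING, monotonicity asked only at singular points (general regime).** `σ.DecreaseShape → σ.StopsShape → σ.TopSingShape →
σ.MonotoneShape → TerminatesWhole N Rd Rg`: along a whole-∇ run the top `σ`-strings strictly decrease and their lengths
are bounded by the initial one, which the tree's `lexLT_no_infinite_descent_of_length_le` forbids. [folklore] -/
theorem terminatesWhole_of_shapes_sing (hD : σ.DecreaseShape Rd Rg) (hM : σ.StopsShape Rd Rg)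
    (hT : σ.TopSingShape Rd Rg) (hL : σ.MonotoneSingShape Rd Rg) : TerminatesWhole N Rd Rg := by
  intro r hw hRg
  choose η hηn hηc hT1 hT2 using fun k => hT (r.A k) (r.E k) (r.R k) (hRg k) (r.reads k)
  have hstep : ∀ k, InvString.LexLT (σ.str (r.R (k + 1)) (η (k + 1))) (σ.str (r.R k) (η k)) ∧
      σ.len (r.R (k + 1)) ≤ σ.len (r.R k) :=
    fun k => σ.descent_of_whole_sing hD hM hL (hRg k) (r.reads k) (r.step k) (hw k) (hT1 k) (hT2 k) (r.E_succ k)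
      (r.R (k + 1)) (r.reads (k + 1)) (hηn (k + 1)) (hηc (k + 1))
  have hm : ∀ k, σ.len (r.R k) ≤ σ.len (r.R 0) := by
    intro k
    induction k with
    | zero => exact le_rfl
    | succ k ih => exact (hstep k).2.trans ih
  refine lexLT_no_infinite_descent_of_length_le (σ.len (r.R 0)) (fun k => σ.str (r.R k) (η k)) (fun k => ?_)
    fun k => (hstep k).1
  rw [σ.length_str]
  exact hm k

end WholeStep

/-! ## One ∇-step: the top string does not increase, and if it stalls `∇(E′) ⊆ ∇′` -/

section NablaStep

variable {N : Notions.{u} n} {Rd : Reading p K N} {Rg : Regime p K} (σ : StringReading p K N)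
variable {A A' : AmbientDatum p K} {E : IdealExponent A.Z} {R : Resume N A E}

/-- POINTWISE COMPARISON across an admitted step under the reading `σ`. Fix a closed `η` realising (T1)/(T2-Sing) of
`TopSingShape` for `R` and a bound `M ≥ σ.len R`. For every closed `ξ′` of `Z′` whose image is singular for `E` and every
résumé `R′` of the transform read by `Rd`: (a) the padded `σ`-string of `R′` at `ξ′` is `≤` the top string of `R`; (b) if
they are EQUAL then `ξ′ ∈ ∇′`. Cases: `ξ′ ∈ ∇′` over the centre — `PrefixShape` makes the new string a prefix of the top
string (`not_lexLT_take`); over the centre off `∇′` — `DecreaseShape`; off the centre — `MonotoneShape` and (T1)/(T2-Sing)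
downstairs. [folklore] -/
theorem padFin_le_of_step_sing (hD : σ.DecreaseShape Rd Rg) (hP : σ.PrefixShape Rd Rg) (hM : σ.StopsShape Rd Rg)
    (hL : σ.MonotoneSingShape Rd Rg) (hRg : Rg A E) (hRd : Rd A E R) (s : Step R A') {η : A.Z}
    (hT1 : ∀ ξ : A.Z, ξ ∈ Literature.AlgebraicGeometry.Hironaka2017.S02Preliminaries.closedPoints A.Z →
      ξ ∈ (R.nabla : Set A.Z) → σ.str R ξ = σ.str R η)
    (hT2 : ∀ ξ : A.Z, ξ ∈ Literature.AlgebraicGeometry.Hironaka2017.S02Preliminaries.closedPoints A.Z →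
      ξ ∈ E.sing → ξ ∉ (R.nabla : Set A.Z) → InvString.LexLT (σ.str R ξ) (σ.str R η))
    {M : ℕ} (hMm : σ.len R ≤ M)
    {E' : IdealExponent A'.Z} (hE' : E' = s.E') (R' : Resume N A' E') (hRd' : Rd A' E' R') {ξ' : A'.Z}
    (hξ' : ξ' ∈ Literature.AlgebraicGeometry.Hironaka2017.S02Preliminaries.closedPoints A'.Z)
    (hξs : s.π ξ' ∈ E.sing) :
    padFin M (σ.str R' ξ') ≤ padFin M (σ.str R η) ∧
      (padFin M (σ.str R' ξ') = padFin M (σ.str R η) →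
        ξ' ∈ strictTransformSet s.π (s.D : Set A.Z) (R.nabla : Set A.Z)) := by
  subst hE'
  have hζ := s.apply_mem_closedPoints hξ'
  have hM' : σ.len R' ≤ M := (hM A E R hRg hRd A' s R' hRd').trans hMm
  have hlenη : (σ.str R η).length ≤ M := by rw [σ.length_str]; exact hMm
  have hlenξ' : (σ.str R' ξ').length ≤ M := by rw [σ.length_str]; exact hM'
  have hlenζ : (σ.str R (s.π ξ')).length ≤ M := by rw [σ.length_str]; exact hMm
  by_cases hDζ : s.π ξ' ∈ (s.D : Set A.Z)
  · have hin : s.π ξ' ∈ (R.nabla : Set A.Z) := s.centre.subset_nabla hDζ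
    have eζ : σ.str R (s.π ξ') = σ.str R η := hT1 _ hζ hin
    by_cases hDP : ξ' ∈ strictTransformSet s.π (s.D : Set A.Z) (R.nabla : Set A.Z)
    · -- on `∇′`: the new string is a prefix of the top string
      have htake : σ.str R' ξ' = (σ.str R η).take (σ.len R') := by
        rw [← eζ]
        exact hP A E R hRg hRd A' s R' hRd' ξ' hξ' hDP
      have hle : padFin M (σ.str R' ξ') ≤ padFin M (σ.str R η) := by
        rw [htake]
        by_contra hlt
        rw [not_le] at hlt
        have hlen2 : ((σ.str R η).take (σ.len R')).length ≤ M :=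
          (List.length_take_le' _ _).trans hlenη
        exact not_lexLT_take (σ.str R η) (σ.len R') ((lexLT_iff_padFin_lt hlenη hlen2).mpr hlt)
      exact ⟨hle, fun _ => hDP⟩
    · -- over the centre, off `∇′`: Eq. (127)
      have h127 := hD A E R hRg hRd A' s R' hRd' ξ' hξ' hDζ hDP
      rw [eζ] at h127
      have hlt : padFin M (σ.str R' ξ') < padFin M (σ.str R η) := (lexLT_iff_padFin_lt hlenξ' hlenη).mp h127
      exact ⟨hlt.le, fun heq => absurd heq hlt.ne⟩
  · -- off the centre: not above the string downstairs
    have hmono := hL A E R hRg hRd A' s R' hRd' ξ' hξ' hξs hDζ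
    have hle0 : padFin M (σ.str R' ξ') ≤ padFin M (σ.str R (s.π ξ')) := by
      rw [lexLT_iff_padFin_lt hlenζ hlenξ', not_lt] at hmono
      exact hmono
    by_cases hin : s.π ξ' ∈ (R.nabla : Set A.Z)
    · have eζ : σ.str R (s.π ξ') = σ.str R η := hT1 _ hζ hin
      rw [eζ] at hle0
      exact ⟨hle0, fun _ => strictTransformSet.preimage_diff_subset s.π _ _ ⟨hin, hDζ⟩⟩
    · have hlt' : padFin M (σ.str R (s.π ξ')) < padFin M (σ.str R η) :=
        (lexLT_iff_padFin_lt hlenζ hlenη).mp (hT2 _ hζ hξs hin)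
      have hlt := hle0.trans_lt hlt'
      exact ⟨hlt.le, fun heq => absurd heq hlt.ne⟩

/-- IF THE TOP `σ`-STRING DOES NOT DROP, `∇(E′) ⊆ ∇′`: with closed `η`, `η′` realising (T1)/(T2-Sing) for `R` and (T1) for
`R′`, if the padded top strings agree then every closed point of `∇(E′)` lies in `∇′` (pointwise comparison), hence so
does the closed set `∇(E′)` (`Z′` Jacobson). [folklore] -/
theorem nabla_subset_strictTransformSet_of_padFin_eq_sing (hD : σ.DecreaseShape Rd Rg)
    (hP : σ.PrefixShape Rd Rg) (hM : σ.StopsShape Rd Rg) (hL : σ.MonotoneSingShape Rd Rg) (hRg : Rg A E) (hRd : Rd A E R) (s : Step R A') {η : A.Z}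
    (hT1 : ∀ ξ : A.Z, ξ ∈ Literature.AlgebraicGeometry.Hironaka2017.S02Preliminaries.closedPoints A.Z →
      ξ ∈ (R.nabla : Set A.Z) → σ.str R ξ = σ.str R η)
    (hT2 : ∀ ξ : A.Z, ξ ∈ Literature.AlgebraicGeometry.Hironaka2017.S02Preliminaries.closedPoints A.Z →
      ξ ∈ E.sing → ξ ∉ (R.nabla : Set A.Z) → InvString.LexLT (σ.str R ξ) (σ.str R η))
    {M : ℕ} (hMm : σ.len R ≤ M)
    {E' : IdealExponent A'.Z} (hE' : E' = s.E') (R' : Resume N A' E') (hRd' : Rd A' E' R') {η' : A'.Z}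
    (hT1' : ∀ ξ' : A'.Z, ξ' ∈ Literature.AlgebraicGeometry.Hironaka2017.S02Preliminaries.closedPoints A'.Z →
      ξ' ∈ (R'.nabla : Set A'.Z) → σ.str R' ξ' = σ.str R' η')
    (heq : padFin M (σ.str R' η') = padFin M (σ.str R η)) :
    (R'.nabla : Set A'.Z) ⊆ strictTransformSet s.π (s.D : Set A.Z) (R.nabla : Set A.Z) := by
  subst hE'
  haveI := A'.smooth
  haveI : JacobsonSpace A'.Z := LocallyOfFiniteType.jacobsonSpace A'.hom
  have h1 : ∀ ξ' : A'.Z, ξ' ∈ Literature.AlgebraicGeometry.Hironaka2017.S02Preliminaries.closedPoints A'.Z →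
      ξ' ∈ (R'.nabla : Set A'.Z) → ξ' ∈ strictTransformSet s.π (s.D : Set A.Z) (R.nabla : Set A.Z) := by
    intro ξ' hc hn
    refine (σ.padFin_le_of_step_sing hD hP hM hL hRg hRd s hT1 hT2 hMm rfl R' hRd' hc
      (s.apply_mem_sing (R'.nabla_subset_sing hn))).2 ?_
    rw [hT1' ξ' hc hn]
    exact heq
  have hcl : closure ((R'.nabla : Set A'.Z) ∩ _root_.closedPoints A'.Z) = (R'.nabla : Set A'.Z) :=
    closure_inter_closedPoints R'.nabla.isClosed
  rw [← hcl]
  exact closure_minimal (fun x hx => h1 x hx.2 hx.1) (strictTransformSet.isClosed _ _ _)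

end NablaStep

/-! ## The component-wise reduction for every string reading, in a regime of bounded dimension -/

section Reduction

variable {N : Notions.{u} n} {Rd : Reading p K N} {Rg : Regime p K} (σ : StringReading p K N)

/-- **COMPONENT-WISE REDUCTION FOR EVERY STRING READING, monotonicity asked only at singular points.** Let the regime `Rg` lie inside `dimLE d`. If for states in `Rg`
(notion instance `N`, reading `Rd`) the `σ`-shapes hold — Eq. (127) off `∇′` over the centre (`DecreaseShape`), the prefix
form of Eq. (128) on `∇′` (`PrefixShape`), `m′ ≤ m` (`StopsShape`), terminal plat = top `σ`-stratum of `Sing(E)`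
(`TopSingShape`), strings not going up off the centre (`MonotoneShape`) — then there is NO infinite ∇-centred run inside `Rg`
(`TerminatesNabla`). OUR MEASURE v2: (padded top `σ`-string, `compMeasure d ∇(E_k)`), Dershowitz–Manna in the second
coordinate; as `terminatesNabla_of_decrease_mono` (the instance `σ = readingM`). [folklore] -/
theorem terminatesNabla_of_shapes_sing {d : ℕ} (hdim : ∀ A E, Rg A E → Regime.dimLE d A E)
    (hD : σ.DecreaseShape Rd Rg) (hP : σ.PrefixShape Rd Rg) (hM : σ.StopsShape Rd Rg) (hT : σ.TopSingShape Rd Rg)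
    (hL : σ.MonotoneSingShape Rd Rg) : TerminatesNabla N Rd Rg := by
  intro r hRg
  choose η hηn hηc hT1 hT2 using fun k => hT (r.A k) (r.E k) (r.R k) (hRg k) (r.reads k)
  have hmstep : ∀ k, σ.len (r.R (k + 1)) ≤ σ.len (r.R k) := fun k =>
    σ.stops_le hM (hRg k) (r.reads k) (r.step k).toStep (r.E_succ k) (r.R (k + 1)) (r.reads (k + 1))
  have hm : ∀ k, σ.len (r.R k) ≤ σ.len (r.R 0) := by
    intro k
    induction k with
    | zero => exact le_rfl
    | succ k ih => exact (hmstep k).trans ih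
  have hηs : ∀ k, (r.step k).toStep.π (η (k + 1)) ∈ (r.E k).sing := by
    intro k
    have h1 : η (k + 1) ∈ (r.E (k + 1)).sing := (r.R (k + 1)).nabla_subset_sing (hηn (k + 1))
    rw [r.E_succ k] at h1
    exact (r.step k).toStep.apply_mem_sing h1
  have hfin : ∀ k, (componentsIn ((r.R k).nabla : Set (r.A k).Z)).Finite := fun k => by
    haveI := (r.A k).smooth
    haveI := (r.A k).quasiCompact
    haveI : IsLocallyNoetherian (r.A k).Z := LocallyOfFiniteType.isLocallyNoetherian (r.A k).hom
    haveI : CompactSpace (r.A k).Z := QuasiCompact.compactSpace_of_compactSpace (r.A k).hom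
    haveI : IsNoetherian (r.A k).Z := {}
    exact componentsIn.finite _
  have hcoh : ∀ (k) (x : (r.A k).Z), Order.coheight x ≤ d := fun k =>
    (topologicalKrullDim_le_iff_forall_coheight_le _ d).mp (hdim _ _ (hRg k))
  have hstep : ∀ k,
      padFin (σ.len (r.R 0)) (σ.str (r.R (k + 1)) (η (k + 1))) ≤ padFin (σ.len (r.R 0)) (σ.str (r.R k) (η k)) ∧
        (padFin (σ.len (r.R 0)) (σ.str (r.R (k + 1)) (η (k + 1))) = padFin (σ.len (r.R 0)) (σ.str (r.R k) (η k)) →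
          Multiset.IsDershowitzMannaLT (compMeasure d ((r.R (k + 1)).nabla : Set (r.A (k + 1)).Z))
            (compMeasure d ((r.R k).nabla : Set (r.A k).Z))) := by
    intro k
    refine ⟨(σ.padFin_le_of_step_sing hD hP hM hL (hRg k) (r.reads k) (r.step k).toStep (hT1 k) (hT2 k) (hm k)
      (r.E_succ k) (r.R (k + 1)) (r.reads (k + 1)) (hηc (k + 1)) (hηs k)).1, fun heq => ?_⟩
    have hsub := σ.nabla_subset_strictTransformSet_of_padFin_eq_sing hD hP hM hL (hRg k) (r.reads k) (r.step k).toStep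
      (hT1 k) (hT2 k) (hm k) (r.E_succ k) (r.R (k + 1)) (r.reads (k + 1)) (hT1 (k + 1)) heq
    haveI : IsIso ((r.step k).toStep.π ∣_
        ⟨((r.step k).toStep.D : Set (r.A k).Z)ᶜ, (r.step k).toStep.D.isClosed.isOpen_compl⟩) :=
      (r.step k).toStep.blowup.isIso_morphismRestrict (by simpa using disjoint_compl_left)
    exact isDershowitzMannaLT_compMeasure (r.step k).toStep.π (r.step k).toStep.D.isClosed (r.R k).nabla.isClosed
      (hfin k) (r.step k).component.mem_componentsIn (r.R (k + 1)).nabla.isClosed (hfin (k + 1)) hsub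
      (hcoh (k + 1))
  exact no_stalling_descent_wf Multiset.wellFounded_isDershowitzMannaLT
    (fun k => padFin (σ.len (r.R 0)) (σ.str (r.R k) (η k)))
    (fun k => compMeasure d ((r.R k).nabla : Set (r.A k).Z)) (fun k => (hstep k).1) fun k => (hstep k).2

end Reduction

end StringReading

/-! ## Rung (ii), final forms: every string reading, monotonicity at singular points only -/

section RungIIFinal

variable (N : Notions.{u} n) (Rd : Reading p K N) (σ : StringReading p K N)

/-- **RUNG (ii), WHOLE-∇, FINAL FORM (any string reading `σ`).** `σ.DecreaseShape Rd regimeII → σ.StopsShape Rd regimeII →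
σ.TopSingShape Rd regimeII → σ.MonotoneSingShape Rd regimeII → TerminatesWholeII N Rd`. [folklore] -/
theorem terminatesWholeII_of_shapes_sing (hD : σ.DecreaseShape Rd regimeII) (hM : σ.StopsShape Rd regimeII)
    (hT : σ.TopSingShape Rd regimeII) (hL : σ.MonotoneSingShape Rd regimeII) : TerminatesWholeII N Rd :=
  σ.terminatesWhole_of_shapes_sing hD hM hT hL

/-- **RUNG (ii), ∇-CENTRED (registered shape), FINAL FORM (any string reading `σ` — (M) `readingM N`, (M⁺) `readingMSucc N`,
…).** For the NAMED notion instance `N` and reading `Rd`: `σ.DecreaseShape Rd regimeII → σ.PrefixShape Rd regimeII →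
σ.StopsShape Rd regimeII → σ.TopSingShape Rd regimeII → σ.MonotoneSingShape Rd regimeII → TerminatesNablaII N Rd` — the typed
∇-centred procedure admits no infinite run through threefold-hypersurface states; the dimension bound `3` (first binder of
stmt-16156) makes OUR MEASURE v2 well-founded. All five shapes are HYPOTHESES about `N`; nothing of the manuscript is
asserted. [folklore] -/
theorem terminatesNablaII_of_shapes_sing (hD : σ.DecreaseShape Rd regimeII) (hP : σ.PrefixShape Rd regimeII)
    (hM : σ.StopsShape Rd regimeII) (hT : σ.TopSingShape Rd regimeII) (hL : σ.MonotoneSingShape Rd regimeII) :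
    TerminatesNablaII N Rd :=
  σ.terminatesNabla_of_shapes_sing (d := 3) (fun _ _ h => h.1) hD hP hM hT hL

/-- Rung (ii), final form, READING (M) with the named shapes of Threefolds.lean: `DecreaseII → EqualityII → StopsMonotoneII →
NablaTopSingII → (readingM N).MonotoneSingShape Rd regimeII → TerminatesNablaII`. [folklore] -/
theorem terminatesNablaII_of_decrease_monoSing (hD : DecreaseII N Rd) (hEq : EqualityII N Rd) (hM : StopsMonotoneII N Rd)
    (hT : NablaTopSingII N Rd) (hL : (readingM N).MonotoneSingShape Rd regimeII) : TerminatesNablaII N Rd :=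
  terminatesNablaII_of_shapes_sing N Rd (readingM N) (decreaseShape_readingM hD) (prefixShape_readingM hEq hM)
    (stopsShape_readingM hM) (topSingShape_readingM hT) hL

/-- Rung (ii), final form, READING (M⁺): `DecreaseIISucc → EqualityIISucc → StopsMonotoneII →
(readingMSucc N).TopSingShape Rd regimeII → (readingMSucc N).MonotoneSingShape Rd regimeII → TerminatesNablaII`. [folklore] -/
theorem terminatesNablaII_of_decreaseSucc_monoSing (hD : DecreaseIISucc N Rd) (hEq : EqualityIISucc N Rd)
    (hM : StopsMonotoneII N Rd) (hT : (readingMSucc N).TopSingShape Rd regimeII)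
    (hL : (readingMSucc N).MonotoneSingShape Rd regimeII) : TerminatesNablaII N Rd :=
  terminatesNablaII_of_shapes_sing N Rd (readingMSucc N) (decreaseShape_readingMSucc hD) (prefixShape_readingMSucc hEq hM)
    (stopsShape_readingMSucc hM) hT hL

/-- Rung (ii), final form, READING (M⁺), with both one-step shapes from the typed candidate `Thm16_6 n (primeRSucc N Rd) _` AS
A HYPOTHESIS (shared anchor `decreaseAlongStepsSucc_of_thm16_6`, `equalityAlongStepsSucc_of_thm16_6`). [folklore] -/
theorem terminatesNablaII_of_thm16_6Succ_monoSing [PerfectField K]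
    {pPosiEmptyAt : ∀ {W : Scheme.{u}}, IdealExponent W → W → Prop}
    (h : Thm16_6 (p := p) (K := K) n (primeRSucc N Rd) pPosiEmptyAt) (hM : StopsMonotoneII N Rd)
    (hT : (readingMSucc N).TopSingShape Rd regimeII) (hL : (readingMSucc N).MonotoneSingShape Rd regimeII) :
    TerminatesNablaII N Rd :=
  terminatesNablaII_of_decreaseSucc_monoSing N Rd (decreaseAlongStepsSucc_of_thm16_6 N Rd h regimeII)
    (equalityAlongStepsSucc_of_thm16_6 N Rd h regimeII) hM hT hL

end RungIIFinal

section HostFinal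

variable {k : Type u} [Field k] [CharP k p] {N : Notions.{u} n} {Rd : Reading p k N}

/-- **RUNG (ii) IN THE WORDS OF THE HOST ITEM, FINAL FORM (any string reading `σ`)**: the five `σ`-shapes at `regimeII` for the
named `N`, `Rd` imply that from every input `(k, X, I, m)` of stmt-16156 (`k` perfect of characteristic `p`, `X` integral
regular locally of finite type quasi-compact over `k` of Krull dimension `≤ 3`, `I` effective Cartier, `m`) the ∇-centred typed
procedure admits no infinite run. All shapes are HYPOTHESES; 16156's conclusion is neither used nor derived. [folklore] -/
theorem not_divergesFromNabla_hostState_of_shapes_sing [PerfectField k] (σ : StringReading p k N)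
    (hD : σ.DecreaseShape Rd regimeII) (hP : σ.PrefixShape Rd regimeII) (hM : σ.StopsShape Rd regimeII)
    (hT : σ.TopSingShape Rd regimeII) (hL : σ.MonotoneSingShape Rd regimeII) (X : Scheme.{u}) (s : X ⟶ Spec (.of k))
    [LocallyOfFiniteType s] [QuasiCompact s] [IsIntegral X] (hreg : Scheme.IsRegular X) (hdim : topologicalKrullDim X ≤ 3)
    (I : X.IdealSheafData) (hIc : IsEffectiveCartier I) (m : ℕ) (Rg : Regime p k) :
    ¬ DivergesFromNabla N Rd Rg
        (⟨X, s, inferInstance, smooth_of_isRegular_of_perfectField s hreg, inferInstance⟩ : AmbientDatum p k) ⟨I, m⟩ :=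
  not_divergesFromNabla_hostState (terminatesNablaII_of_shapes_sing N Rd σ hD hP hM hT hL) X s hreg hdim I hIc m Rg

end HostFinal

end CampaignW46

end Summit.ResolutionOfSingularities.ResolutionOfSingularities.Theorems

end
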